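import Literature.MathematicalPhysics.QuantumFieldTheory.Balaban1983to89.B9B8KnitHolderZeroOfGlob
import Literature.MathematicalPhysics.QuantumFieldTheory.Balaban1983to89.B9SupplySockB9P3ZdLettersOmega
import Literature.MathematicalPhysics.QuantumFieldTheory.Balaban1983to89.B8Eq154Local
import Literature.MathematicalPhysics.QuantumFieldTheory.Balaban1983to89.B8Thm2TorusMember

/-!
# `Balaban1983to89.B9B8KnitTorusSocketLevelZero` — T. Bałaban, *Propagators and renormalization transformations for lattice gauge theories. I*, Commun.
# Math. Phys. **95** (1984) 17–40 [Balaban1985RegularSpaces], (1.58)–(1.59) p. 86 (the B-operators of Theorem 2; the weighted norms after (1.55) p. 86),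
# (1.1)–(1.2) p. 76, (1.41) p. 83, p. 77 («Ω_j = T_η»); *Averaging operations for lattice gauge theories*, CMP **98** (1985) 17–51 [Balaban1985Averaging],
# (127) p. 37 («Q_0 = id»); *Propagators for lattice gauge theories in a background field*, CMP **99** (1985) 389–434 [Balaban1985BackgroundPropagators],
# (3.23) p. 394, (3.40) p. 397: **THE LEVEL-ZERO MEMBER OF pub-ymgap's GUARDED PERIODIC SOCKET `SockB9P3Per … 0` IS ELEMENTARY** — the (B)-line bond
# junction, file F8.

statement-level skeleton of published theorems with citation tags; proofs where landed; nothing here is a claim about the Yang–Mills mass gap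

THE POINT.  The [B8] Thm 2 torus assembler `B8Thm2T3FamilyBinderSockPer.hThm2_of_core_sockPer` (sub-row G-B8-T2S file A17) takes the (B)-arrow as
`∀ m′ ≤ K − n, SockB9P3Per P₀ L B₀ B₀β c_P β_H len η m′ {ℤ^{d}} torusLam torusLamb` at ONE constant set — INCLUDING the truncation `m′ = 0`, for which no
k-level member of the catalogue exists (`1 ≤ n` there) and to which the def-Y road (files 8c, F4–F7: `n ≥ 1`) does not apply.  At `k = 0` the socket is
elementary: the averaging composite of its right-hand side is the identity (`linCovIter … 0 = id`, [B7] (127)), so `|B₁| = sup‖iηA′‖ = η·sup‖A′‖` as soon as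
the level-`0` constraint-bond set is everything (`torusLamb 0 0 = univ`), while each left-hand side is `η^{|α|}·sup` of a lattice differential operator of
order `|α| − 1` in `A′` with unitary transports: `|A′|₍₋₁₎ = η·sup‖A′‖`, `|∇^ηA′|₍₋₂₎ ≤ 2η·sup‖A′‖`, the third line IS `|J|₍₋₃₎`, `|Δ^ηA′|₍₋₃₎ ≤ 4d·η·sup‖A′‖`,
and the Hölder line at `β = 0` is `≤ 4η·sup‖A′‖` (`hquot ≤ ‖F x′‖ + ‖F x‖`).  Hence the level-zero socket holds for EVERY period `P`, threshold `c_P`, length,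
domain sequence `Ω`, Landau data `Λs` and every `Λb` with `Λb 0 0 = univ`, as soon as `B₀ ≥ max(2, 4d)`, `B₀β ≥ 4` — and the assembler's uniform constant set
is reached from the `m′ ≥ 1` members (F6∕F7) by pub-ymgap's monotonicity `B9Thm33SocketUniformLevelsZdPer.sockB9P3Per_mono` (larger `B₀`, `B₀β`).

WHAT THIS FILE PROVES (all `theorem`s; 0 `def`, 0 new named facts, 0 `sorry`; standard axioms; any C⋆-algebra fibre).
* `weight_zero_level` (`(L⁰η)^{−(−n)} = ηⁿ`), ★★★ `sockB9P3Per_levelZero` (general `P, L, c_P, len, Ω, Λs`, `Λb 0 0 = univ`, `β = 0`, `k = 0`), ★★★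
  `sockB9P3Per_torus_levelZero` (the torus data of record: `Ω_j = ℤ^d`, `torusLam`, `torusLamb`).

HONEST FRAMING.  Elementary bookkeeping at truncation `0` (print's induction starts at `k ≥ 1`; the `m′ = 0` instance of the assembler's hypothesis is a
formal member of the displayed family, discharged here so that it does not block the assembly); the tree's pointwise bounds
`B9SupplySockB9P3ZdLettersOmega.norm_covDerivFwd_le ∕ norm_covLap_le`, `B9B8KnitHolderZeroOfGlob.hquot_zero_le`, `B8Eq154Local.norm_iEta_apply` BY NAME;
nothing of pub-ymgap's socket files or the lane's files is modified; `stub_PV3A` NOT discharged; counts unmoved; one finite 𝕋⁴ programme at fixed ε,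
Bałaban AS PRINTED; the YM mass gap (Clay) is NOT proved by any of this — nothing continuum ∕ ℝ⁴ ∕ OS.  Cell `lit-balaban`, seat t2s-1 g8 («B8 §3 Thm 2
TORUS SUPPLIER», (B)-line bond junction); `--supports stmt-QuantumFields-19200`.

References: T. Bałaban, CMP 95 (1984) 17–40 [Balaban1985RegularSpaces] (1.1)–(1.2) p.76, p.77, (1.41) p.83, p.86, (1.58)–(1.59) p.86; CMP 98 (1985) 17–51
[Balaban1985Averaging] (127) p.37, (56)–(57) p.27; CMP 99 (1985) 389–434 [Balaban1985BackgroundPropagators] (3.23) p.394, (3.40) p.397.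
-/

noncomputable section

namespace Literature.MathematicalPhysics.QuantumFieldTheory.Balaban1983to89.B9B8KnitTorusSocketLevelZero

open scoped BigOperators
open B7Prop1Explicit renaming Site → LSite
open B7Prop1Explicit (U1 e)
open B7Prop2Explicit (unitaryUnits unitaryUnits_le_U1)
open B7Prop4GeneralLevels (linCovIter)
open B8Ineq132 (covDerivFwd InAk BondTouches)
open B8Eq184Proof (cfgExp)
open B8Lemma1NonAbelian (mulCfg)
open B8Eq140Level (SideTouches)
open B8Eq146AExpansion (iEta plaqCovDeriv)
open B8Eq143PlaqExpansion (pdiv)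
open B8Eq155JBound (Jcur wsup wsup_le le_wsup wsup_nonneg)
open B8Eq154Local (norm_iEta_apply)
open B8ScaledSupNorm (bondNorm msup weight msup_le msup_nonneg weight_neg_natCast)
open B8Eq138LandauZd (IsLandau138W covLap)
open B8LeafModelZd3SockPer (SockB9P3Per)
open B8Thm4TorusAt (torusLam)
open B8Thm2TorusMember (torusLamb mem_torusLamb_iff)
open B9Eq340HolderZd (hquot AdmPair)
open B9SupplySockB9P3ZdLettersOmega (norm_covDerivFwd_le norm_covLap_le)
open B9B8KnitHolderZeroOfGlob (hquot_zero_le)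
open T4TermwiseTorus (IsPeriodic)

variable {d : ℕ} {𝔸 : Type*} [CStarAlgebra 𝔸] [Nontrivial 𝔸]

/-- the level-`0` weights: `(L⁰η)^{−(−n)} = ηⁿ`. [cite: Balaban1985RegularSpaces, p.86 (definition after (1.55))] -/
theorem weight_zero_level (L : ℕ) (η : ℝ) (n : ℕ) : weight L η (-(n : ℝ)) 0 = η ^ n := by
  rw [weight_neg_natCast, pow_zero, one_mul]

/-- ★★★ **THE LEVEL-ZERO MEMBER OF THE GUARDED PERIODIC SOCKET IS ELEMENTARY.**  At truncation `k = 0` the averaging composite `Q_0` is the identity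
(`linCovIter … 0 = id`), so the right-hand side `B₀(|J|₍₋₃₎ + |B₁|)` of [B8] (1.59) contains `|B₁| = sup‖iηA′‖ = η·sup‖A′‖` whenever the constraint-bond
set at level `0` is everything (`Λb 0 0 = univ`, as for `torusLamb 0`); and every left-hand side of (1.59) at `k = 0` is a weighted sup `η^{|α|}·sup‖𝒟A′‖` of a
lattice differential operator `𝒟` of order `|α| − 1` with unitary transports, hence `≤ c(d)·η·sup‖A′‖` (`‖∇^η f‖ ≤ η⁻¹(‖f(x+e)‖ + ‖f(x)‖)`, `‖Δ^η f‖ ≤ 4dη⁻²sup‖f‖`,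
the third line IS `|J|₍₋₃₎`, the Hölder quotient at `β = 0` is `≤ ‖F x′‖ + ‖F x‖`).  So `SockB9P3Per P L B₀ B₀β c_P 0 len η 0 Ω Λs Λb` holds for EVERY period,
threshold, length, domain sequence and Landau data as soon as `B₀ ≥ max(2, 4d)` and `B₀β ≥ 4` — no Green's function, no regularity of `U₀` beyond unitarity.
[cite: Balaban1985RegularSpaces, (1.58)–(1.59) p.86, (1.1)–(1.2) p.76, (1.41) p.83; Balaban1985Averaging, (127) p.37 («Q_0 = id»); Balaban1985BackgroundPropagators, (3.23) p.394, (3.40) p.397] -/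
theorem sockB9P3Per_levelZero (P L : ℕ) {B₀ B₀β : ℝ} (hB2 : 2 ≤ B₀) (hBd : 4 * (d : ℝ) ≤ B₀) (hBβ : 4 ≤ B₀β) (cP : ℝ) (len : LSite d → ℝ)
    {η : ℝ} (hη : 0 < η) (Ω : ℕ → Set (LSite d)) (Λs : ℕ → ℕ → Set (LSite d)) {Λb : ℕ → ℕ → Set (LSite d × Fin d)} (hΛ : ∀ b, b ∈ Λb 0 0) :
    SockB9P3Per (𝔸 := 𝔸) P L B₀ B₀β cP 0 len η 0 Ω Λs Λb := by
  intro α₀ α₂ _ _ hα₂ _ U₀ W hU₀ _ _ _ _ _ _ A' _ _ hexp hoff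
  have hU1 : ∀ y κ, U₀ y κ ∈ U1 𝔸 := fun y κ => unitaryUnits_le_U1 (hU₀ y κ)
  have hB1 : 1 ≤ B₀ := by linarith
  have hB0 : 0 ≤ B₀ := by linarith
  -- a uniform bound on `A′` from the exponent data: on touching sides (1.41), off them `A′ = 0`
  have hA2 : ∀ y τ, ‖A' y τ‖ ≤ α₂ * η⁻¹ := by
    intro y τ
    by_cases h : SideTouches (Ω 0) y τ
    · have := (hexp 0 le_rfl y τ h).2
      simpa using this
    · rw [hoff y τ fun j hj => by rwa [Nat.le_zero.1 hj], norm_zero]; positivity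
  -- the `|B₁|` term at level zero dominates `η‖A′‖`
  set S : ℝ := wsup 1 (fun p : {p : ℕ × (LSite d × Fin d) // p.1 ≤ 0 ∧ p.2 ∈ Λb 0 p.1} =>
    linCovIter L U₀ (iEta η A') p.1.1 p.1.2.1 p.1.2.2) with hSdef
  have hfam : ∀ p : {p : ℕ × (LSite d × Fin d) // p.1 ≤ 0 ∧ p.2 ∈ Λb 0 p.1},
      1 * ‖linCovIter L U₀ (iEta η A') p.1.1 p.1.2.1 p.1.2.2‖ ≤ α₂ := by
    rintro ⟨⟨j, y, τ⟩, hj, -⟩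
    obtain rfl : j = 0 := Nat.le_zero.1 hj
    show 1 * ‖iEta η A' y τ‖ ≤ α₂
    rw [one_mul, norm_iEta_apply hη.le]
    calc η * ‖A' y τ‖ ≤ η * (α₂ * η⁻¹) := mul_le_mul_of_nonneg_left (hA2 y τ) hη.le
      _ = α₂ := by field_simp
  have hS : ∀ y τ, η * ‖A' y τ‖ ≤ S := fun y τ => by
    have h := le_wsup hfam ⟨(0, (y, τ)), le_rfl, hΛ (y, τ)⟩
    rwa [one_mul, show linCovIter L U₀ (iEta η A') 0 y τ = iEta η A' y τ from rfl, norm_iEta_apply hη.le] at h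
  have hS0 : 0 ≤ S := wsup_nonneg zero_le_one _
  have hs : ∀ y τ, ‖A' y τ‖ ≤ S * η⁻¹ := fun y τ => by
    rw [le_mul_inv_iff₀ hη, mul_comm]; exact hS y τ
  set J : ℝ := bondNorm L 0 η (-(3 : ℝ)) Ω (fun x μ => Jcur η U₀ A' μ x) with hJdef
  have hJ0 : 0 ≤ J := msup_nonneg L 0 hη.le _ _ _
  have hRHS : ∀ {c : ℝ}, c ≤ B₀ → c * S ≤ B₀ * (J + S) := fun {c} hc =>
    (mul_le_mul_of_nonneg_right hc hS0).trans (mul_le_mul_of_nonneg_left (by linarith) hB0)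
  have hw1 : weight L η (-(1 : ℝ)) 0 = η := by rw [show (-(1 : ℝ)) = -((1 : ℕ) : ℝ) by norm_num, weight_zero_level, pow_one]
  have hw2 : weight L η (-(2 : ℝ)) 0 = η ^ 2 := by rw [show (-(2 : ℝ)) = -((2 : ℕ) : ℝ) by norm_num, weight_zero_level]
  have hw3 : weight L η (-(3 : ℝ)) 0 = η ^ 3 := by rw [show (-(3 : ℝ)) = -((3 : ℕ) : ℝ) by norm_num, weight_zero_level]
  -- the gradient bound used twice
  have hgrad : ∀ (μ τ : Fin d) (x : LSite d), ‖covDerivFwd η U₀ μ (fun z => A' z τ) x‖ ≤ η⁻¹ * (2 * (S * η⁻¹)) := fun μ τ x =>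
    (norm_covDerivFwd_le hη (hU1 x μ) _).trans (mul_le_mul_of_nonneg_left (by linarith [hs (x + e μ) τ, hs x τ]) (inv_nonneg.2 hη.le))
  refine ⟨?_, ?_, ?_, ?_, ?_⟩
  · -- `|A′|₍₋₁₎ ≤ B₀(|J|₍₋₃₎ + |B₁|)`
    refine msup_le (by positivity) fun j hj b _ => ?_
    obtain rfl : j = 0 := Nat.le_zero.1 hj
    rw [hw1]
    exact (hS b.1 b.2).trans (by simpa using hRHS hB1)
  · -- `|∇^η A′|₍₋₂₎`
    refine msup_le (by positivity) fun j hj t _ => ?_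
    obtain rfl : j = 0 := Nat.le_zero.1 hj
    rw [hw2]
    calc η ^ 2 * ‖covDerivFwd η U₀ t.1 (fun z => A' z t.2.1) t.2.2‖ ≤ η ^ 2 * (η⁻¹ * (2 * (S * η⁻¹))) :=
          mul_le_mul_of_nonneg_left (hgrad _ _ _) (by positivity)
      _ = 2 * S := by field_simp
      _ ≤ B₀ * (J + S) := hRHS hB2
  · -- the third line IS `|J|₍₋₃₎`
    show J ≤ B₀ * (J + S)
    nlinarith
  · -- `|Δ^η A′|₍₋₃₎`
    refine msup_le (by positivity) fun j hj b _ => ?_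
    obtain rfl : j = 0 := Nat.le_zero.1 hj
    rw [hw3]
    calc η ^ 3 * ‖covLap η U₀ (fun z => A' z b.2) b.1‖ ≤ η ^ 3 * (4 * d * (η⁻¹ * (η⁻¹ * (S * η⁻¹)))) :=
          mul_le_mul_of_nonneg_left (norm_covLap_le hη hU1 (fun y => hs y b.2) b.1) (by positivity)
      _ = 4 * d * S := by field_simp
      _ ≤ B₀ * (J + S) := hRHS hBd
  · -- the Hölder line at `β = 0`
    refine msup_le (by positivity) fun j hj q _ => ?_
    obtain rfl : j = 0 := Nat.le_zero.1 hj
    rw [show (-(2 + 0 : ℝ)) = -(2 : ℝ) by norm_num, hw2]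
    have hq0 : 0 ≤ hquot η 0 len U₀ (covDerivFwd η U₀ q.1 fun z => A' z q.2.1) q.2.2 := by
      rw [B9Eq340HolderZd.hquot_def, Real.rpow_zero, div_one]; exact norm_nonneg _
    rw [Real.norm_eq_abs, abs_of_nonneg hq0]
    have hle := hquot_zero_le (η := η) len hU₀ (covDerivFwd η U₀ q.1 fun z => A' z q.2.1) q.2.2
    calc η ^ 2 * hquot η 0 len U₀ (covDerivFwd η U₀ q.1 fun z => A' z q.2.1) q.2.2
        ≤ η ^ 2 * (η⁻¹ * (2 * (S * η⁻¹)) + η⁻¹ * (2 * (S * η⁻¹))) :=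
          mul_le_mul_of_nonneg_left (hle.trans (add_le_add (hgrad _ _ _) (hgrad _ _ _))) (by positivity)
      _ = 4 * S := by field_simp; ring
      _ ≤ B₀β * (J + S) := (mul_le_mul_of_nonneg_right hBβ hS0).trans (mul_le_mul_of_nonneg_left (by linarith) (by linarith))

/-- ★★★ **THE LEVEL-ZERO MEMBER OF THE TORUS SOCKET OF RECORD** (`Ω_j = ℤ^{d}`, `Λs = torusLam`, `Λb = torusLamb`, `β = 0`): the `m′ = 0` instance of
the [B8] Thm 2 torus assembler's hypothesis `∀ m′ ≤ K − n, SockB9P3Per P₀ L B₀ B₀β c_P 0 len η m′ {ℤ^d} torusLam torusLamb`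
(`B8Thm2T3FamilyBinderSockPer.hThm2_of_core_sockPer`), for every `B₀ ≥ max(2, 4d)`, `B₀β ≥ 4`. [cite: Balaban1985RegularSpaces, (1.58)–(1.59) p.86, p.77 («Ω_j = T_η»)] -/
theorem sockB9P3Per_torus_levelZero (P L : ℕ) {B₀ B₀β : ℝ} (hB2 : 2 ≤ B₀) (hBd : 4 * (d : ℝ) ≤ B₀) (hBβ : 4 ≤ B₀β) (cP : ℝ)
    (len : LSite d → ℝ) {η : ℝ} (hη : 0 < η) :
    SockB9P3Per (𝔸 := 𝔸) P L B₀ B₀β cP 0 len η 0 (fun _ => (Set.univ : Set (LSite d))) (fun m => torusLam (d := d) m)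
      (fun m => torusLamb (d := d) m) :=
  sockB9P3Per_levelZero P L hB2 hBd hBβ cP len hη _ _ fun b => (mem_torusLamb_iff 0 0 b).2 rfl

end Literature.MathematicalPhysics.QuantumFieldTheory.Balaban1983to89.B9B8KnitTorusSocketLevelZero
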